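import Mathlib.MeasureTheory.Integral.Prod
import Summits.Ventures.LatticeQCDFlow.Scoring.SchwingerDysonU1Link
import HarnessLib

/-!
# The per-link U(1) Schwinger–Dyson identity — UNCONDITIONAL form (tower property, typed)

HONEST FRAMING: exact (Metropolis-corrected) sampling algorithms for lattice gauge theory;
figures of merit are autocorrelation/cost numbers at stated couplings and volumes; no
continuum-physics claim.

Venture `LatticeQCDFlow` (cell pub-lqcd), sub-topic `Scoring`; FANOUT row 10 (`eng-equiv`).  NEW WORK
of the cell (elementary; our own proof).  Companion of `SchwingerDysonU1Link.lean` (same seat), which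
proves the CONDITIONAL statement: for every environment `a : J → ℝ` of the plaquettes through a link,
`∫_0^{2π} Re R · E dθ = ∫_0^{2π} Im R · E dθ = 0` with `E(θ) = exp(β Σ_{P∈J} cos(θ + a_P))`.

Here the tower-property step is typed: let the environment be distributed according to ANY finite
measure `ν` on a measurable space `E` through a measurable map `a : E → (J → ℝ)` (on a lattice: the
law of all other links, with the Boltzmann weight of every plaquette NOT containing the link absorbed
into `ν`); then the residual densities integrate to zero against `ν ⊗ Lebesgue|_(0, 2π]`:

* `integral_sdRe_unconditional`, `integral_sdIm_unconditional`.

Ingredients: the uniform bounds `abs_sdReDensity_le` / `abs_sdImDensity_le`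
(`≤ (1 + |β| |J|) e^{|β| |J|}`, so the densities are integrable against any finite product measure),
measurability in (environment, angle), Fubini (`MeasureTheory.integral_prod`), and the conditional
identities.  Consequence in words: the lattice mean of the chain columns `obs_sd_re` / `obs_sd_im` is
EXACTLY zero under the U(1) Wilson measure at every `β`, volume, dimension and boundary condition —
the property the scorers' key-free `sd_re` identity test (arbiter ruling L2-A15) relies on.
What is NOT here: SU(N); statistical power.
-/

namespace Summit.Ventures.LatticeQCDFlow.Scoring

open Real MeasureTheory intervalIntegral Finset

variable {ι : Type*}

/-! ### Zero mean against ANY law of the environment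

The tower-property step, typed: let the environment (all other links, hence the vector
`a : J → ℝ` of frozen plaquette parts, and the weight of every plaquette NOT containing the link)
be distributed according to ANY finite measure `ν` on a measurable space `E`, through a measurable
map `a : E → (J → ℝ)`; the joint law of (environment, link angle) is then `ν ⊗ Lebesgue|_(0, 2π]`
with density `E(θ; a(e))` (the plaquettes through the link) — the weight of the other plaquettes is
absorbed in `ν`.  Fubini + `integral_sdRe_link` / `integral_sdIm_link` give a vanishing integral of
the residual densities over the product: the UNconditional lattice mean of `obs_sd_re` / `obs_sd_im`
is zero for every `β`, volume, dimension and boundary condition (the environment law is never used).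
-/

section Unconditional

variable {E : Type*} [MeasurableSpace E]

/-- `|Σ_{P∈J} sin(θ + a P)| ≤ |J|`. -/
theorem abs_linkSinSum_le (J : Finset ι) (a : ι → ℝ) (θ : ℝ) : |linkSinSum J a θ| ≤ J.card := by
  unfold linkSinSum
  calc |∑ P ∈ J, Real.sin (θ + a P)| ≤ ∑ P ∈ J, |Real.sin (θ + a P)| := Finset.abs_sum_le_sum_abs _ _
    _ ≤ ∑ _P ∈ J, (1 : ℝ) := Finset.sum_le_sum fun P _ => Real.abs_sin_le_one _
    _ = J.card := by simp

/-- `E(θ) ≤ exp(|β| |J|)`. -/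
theorem linkWeight_le (β : ℝ) (J : Finset ι) (a : ι → ℝ) (θ : ℝ) :
    linkWeight β J a θ ≤ Real.exp (|β| * J.card) := by
  unfold linkWeight
  apply Real.exp_le_exp.mpr
  have hs : |∑ P ∈ J, Real.cos (θ + a P)| ≤ J.card := by
    calc |∑ P ∈ J, Real.cos (θ + a P)| ≤ ∑ P ∈ J, |Real.cos (θ + a P)| := Finset.abs_sum_le_sum_abs _ _
      _ ≤ ∑ _P ∈ J, (1 : ℝ) := Finset.sum_le_sum fun P _ => Real.abs_cos_le_one _
      _ = J.card := by simp
  calc β * ∑ P ∈ J, Real.cos (θ + a P) ≤ |β * ∑ P ∈ J, Real.cos (θ + a P)| := le_abs_self _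
    _ = |β| * |∑ P ∈ J, Real.cos (θ + a P)| := abs_mul _ _
    _ ≤ |β| * J.card := mul_le_mul_of_nonneg_left hs (abs_nonneg _)

/-- Uniform bound `|Re-density| ≤ (1 + |β| |J|) exp(|β| |J|)` (independent of `θ` and of the environment). -/
theorem abs_sdReDensity_le (β : ℝ) (J : Finset ι) (a : ι → ℝ) (P₀ : ι) (θ : ℝ) :
    |sdReDensity β J a P₀ θ| ≤ (1 + |β| * J.card) * Real.exp (|β| * J.card) := by
  unfold sdReDensity
  rw [abs_mul]
  have hw : |linkWeight β J a θ| ≤ Real.exp (|β| * J.card) := by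
    rw [abs_of_pos (by unfold linkWeight; exact Real.exp_pos _)]
    exact linkWeight_le β J a θ
  have h1 : |Real.cos (θ + a P₀) - β * linkSinSum J a θ * Real.sin (θ + a P₀)| ≤ 1 + |β| * J.card := by
    calc |Real.cos (θ + a P₀) - β * linkSinSum J a θ * Real.sin (θ + a P₀)|
        ≤ |Real.cos (θ + a P₀)| + |β * linkSinSum J a θ * Real.sin (θ + a P₀)| := abs_sub _ _
      _ ≤ 1 + |β| * J.card := by
          apply add_le_add (Real.abs_cos_le_one _)
          rw [abs_mul, abs_mul]
          calc |β| * |linkSinSum J a θ| * |Real.sin (θ + a P₀)|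
              ≤ |β| * J.card * 1 := by
                apply mul_le_mul (mul_le_mul_of_nonneg_left (abs_linkSinSum_le J a θ) (abs_nonneg _))
                  (Real.abs_sin_le_one _) (abs_nonneg _)
                positivity
            _ = |β| * J.card := mul_one _
  exact mul_le_mul h1 hw (abs_nonneg _) (by positivity)

/-- Uniform bound `|Im-density| ≤ (1 + |β| |J|) exp(|β| |J|)`. -/
theorem abs_sdImDensity_le (β : ℝ) (J : Finset ι) (a : ι → ℝ) (P₀ : ι) (θ : ℝ) :
    |sdImDensity β J a P₀ θ| ≤ (1 + |β| * J.card) * Real.exp (|β| * J.card) := by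
  unfold sdImDensity
  rw [abs_mul]
  have hw : |linkWeight β J a θ| ≤ Real.exp (|β| * J.card) := by
    rw [abs_of_pos (by unfold linkWeight; exact Real.exp_pos _)]
    exact linkWeight_le β J a θ
  have h1 : |Real.sin (θ + a P₀) + β * linkSinSum J a θ * Real.cos (θ + a P₀)| ≤ 1 + |β| * J.card := by
    calc |Real.sin (θ + a P₀) + β * linkSinSum J a θ * Real.cos (θ + a P₀)|
        ≤ |Real.sin (θ + a P₀)| + |β * linkSinSum J a θ * Real.cos (θ + a P₀)| := abs_add_le _ _
      _ ≤ 1 + |β| * J.card := by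
          apply add_le_add (Real.abs_sin_le_one _)
          rw [abs_mul, abs_mul]
          calc |β| * |linkSinSum J a θ| * |Real.cos (θ + a P₀)|
              ≤ |β| * J.card * 1 := by
                apply mul_le_mul (mul_le_mul_of_nonneg_left (abs_linkSinSum_le J a θ) (abs_nonneg _))
                  (Real.abs_cos_le_one _) (abs_nonneg _)
                positivity
            _ = |β| * J.card := mul_one _
  exact mul_le_mul h1 hw (abs_nonneg _) (by positivity)

/-- Measurability of the Re-density as a function of (environment, angle) for a measurable environment map. -/
theorem measurable_sdReDensity_env (β : ℝ) (J : Finset ι) (P₀ : ι) (a : E → ι → ℝ) (ha : Measurable a) :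
    Measurable fun p : E × ℝ => sdReDensity β J (a p.1) P₀ p.2 := by
  have hc : ∀ P, Measurable fun p : E × ℝ => p.2 + a p.1 P := fun P =>
    measurable_snd.add ((measurable_pi_apply P).comp (ha.comp measurable_fst))
  have hsum : Measurable fun p : E × ℝ => ∑ P ∈ J, Real.sin (p.2 + a p.1 P) :=
    Finset.measurable_sum J fun P _ => Real.measurable_sin.comp (hc P)
  have hcsum : Measurable fun p : E × ℝ => ∑ P ∈ J, Real.cos (p.2 + a p.1 P) :=
    Finset.measurable_sum J fun P _ => Real.measurable_cos.comp (hc P)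
  have hw : Measurable fun p : E × ℝ => Real.exp (β * ∑ P ∈ J, Real.cos (p.2 + a p.1 P)) :=
    Real.measurable_exp.comp (hcsum.const_mul β)
  have h0c : Measurable fun p : E × ℝ => Real.cos (p.2 + a p.1 P₀) := Real.measurable_cos.comp (hc P₀)
  have h0s : Measurable fun p : E × ℝ => Real.sin (p.2 + a p.1 P₀) := Real.measurable_sin.comp (hc P₀)
  unfold sdReDensity linkSinSum linkWeight
  exact (h0c.sub ((hsum.const_mul β).mul h0s)).mul hw

/-- Measurability of the Im-density as a function of (environment, angle). -/
theorem measurable_sdImDensity_env (β : ℝ) (J : Finset ι) (P₀ : ι) (a : E → ι → ℝ) (ha : Measurable a) :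
    Measurable fun p : E × ℝ => sdImDensity β J (a p.1) P₀ p.2 := by
  have hc : ∀ P, Measurable fun p : E × ℝ => p.2 + a p.1 P := fun P =>
    measurable_snd.add ((measurable_pi_apply P).comp (ha.comp measurable_fst))
  have hsum : Measurable fun p : E × ℝ => ∑ P ∈ J, Real.sin (p.2 + a p.1 P) :=
    Finset.measurable_sum J fun P _ => Real.measurable_sin.comp (hc P)
  have hcsum : Measurable fun p : E × ℝ => ∑ P ∈ J, Real.cos (p.2 + a p.1 P) :=
    Finset.measurable_sum J fun P _ => Real.measurable_cos.comp (hc P)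
  have hw : Measurable fun p : E × ℝ => Real.exp (β * ∑ P ∈ J, Real.cos (p.2 + a p.1 P)) :=
    Real.measurable_exp.comp (hcsum.const_mul β)
  have h0c : Measurable fun p : E × ℝ => Real.cos (p.2 + a p.1 P₀) := Real.measurable_cos.comp (hc P₀)
  have h0s : Measurable fun p : E × ℝ => Real.sin (p.2 + a p.1 P₀) := Real.measurable_sin.comp (hc P₀)
  unfold sdImDensity linkSinSum linkWeight
  exact (h0s.add ((hsum.const_mul β).mul h0c)).mul hw

/-- **Unconditional real part.**  For ANY finite measure `ν` on the environment space and any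
measurable environment map `a : E → (J → ℝ)`:
`∫ d(ν ⊗ Leb|_(0,2π]) (e, θ) ↦ [cos(θ + a_e P₀) − β (Σ_P sin(θ + a_e P)) sin(θ + a_e P₀)] e^{β Σ_P cos(θ + a_e P)} = 0`. -/
theorem integral_sdRe_unconditional (β : ℝ) (J : Finset ι) (P₀ : ι) (ν : Measure E) [IsFiniteMeasure ν]
    (a : E → ι → ℝ) (ha : Measurable a) :
    ∫ p, sdReDensity β J (a p.1) P₀ p.2 ∂(ν.prod (volume.restrict (Set.Ioc 0 (2 * π)))) = 0 := by
  have hmeas := measurable_sdReDensity_env β J P₀ a ha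
  have hint : Integrable (fun p : E × ℝ => sdReDensity β J (a p.1) P₀ p.2)
      (ν.prod (volume.restrict (Set.Ioc 0 (2 * π)))) := by
    refine Integrable.mono' (integrable_const ((1 + |β| * J.card) * Real.exp (|β| * J.card)))
      hmeas.aestronglyMeasurable (Filter.Eventually.of_forall fun p => ?_)
    rw [Real.norm_eq_abs]
    exact abs_sdReDensity_le β J (a p.1) P₀ p.2
  rw [MeasureTheory.integral_prod _ hint]
  have inner : ∀ e : E, ∫ θ, sdReDensity β J (a e) P₀ θ ∂(volume.restrict (Set.Ioc 0 (2 * π))) = 0 := by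
    intro e
    have h := integral_sdRe_link β J (a e) P₀
    rwa [intervalIntegral.integral_of_le (by positivity)] at h
  simp [inner]

/-- **Unconditional imaginary part** (same hypotheses). -/
theorem integral_sdIm_unconditional (β : ℝ) (J : Finset ι) (P₀ : ι) (ν : Measure E) [IsFiniteMeasure ν]
    (a : E → ι → ℝ) (ha : Measurable a) :
    ∫ p, sdImDensity β J (a p.1) P₀ p.2 ∂(ν.prod (volume.restrict (Set.Ioc 0 (2 * π)))) = 0 := by
  have hmeas := measurable_sdImDensity_env β J P₀ a ha
  have hint : Integrable (fun p : E × ℝ => sdImDensity β J (a p.1) P₀ p.2)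
      (ν.prod (volume.restrict (Set.Ioc 0 (2 * π)))) := by
    refine Integrable.mono' (integrable_const ((1 + |β| * J.card) * Real.exp (|β| * J.card)))
      hmeas.aestronglyMeasurable (Filter.Eventually.of_forall fun p => ?_)
    rw [Real.norm_eq_abs]
    exact abs_sdImDensity_le β J (a p.1) P₀ p.2
  rw [MeasureTheory.integral_prod _ hint]
  have inner : ∀ e : E, ∫ θ, sdImDensity β J (a e) P₀ θ ∂(volume.restrict (Set.Ioc 0 (2 * π))) = 0 := by
    intro e
    have h := integral_sdIm_link β J (a e) P₀
    rwa [intervalIntegral.integral_of_le (by positivity)] at h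
  simp [inner]

end Unconditional

end Summit.Ventures.LatticeQCDFlow.Scoring
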